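import Mathlib
import HarnessLib
import Summits.HubbardSuperconductivity.HubbardSuperconductivity.Theorems.KLProgrammeMatsubaraSliceWeight

/-!
# Route `KLProgramme` — crux K3, ENGINE child (`KLRegimeEngineV14`, stmt-HubbardSuperconductivity-19918), stub `stub_engine_step_values`
# (E2-v9): the CUTOFF ALGEBRA of the one-step rung weights — plain rung, Wick rung, plain↔Wick transfer — for the carrier's cutoff `χ₂`,
# their signs and supports, and certified `ds/s`-masses (cell gate-hubbard-kl, seat hubbard-kl-k3c2-p2 «thermal-bar induction n ≤ nScales β + 1»)

With `χ₂ = salmhoferCutoff` and the weight of the fields ABOVE `Λ`, `h_Λ(s) = χ₂(s/Λ²)` (`hubbardCutoffWeightCT`), write at step `n − 1 → n`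
`a := χ₂(s/Λ_n²)` (hard above `n`) and `b := χ₂(s/Λ_{n−1}²)` (hard above `n − 1`, `Λ_{n−1} = 4Λ_n`; `0 ≤ b ≤ a ≤ 1`).  Then (all weights multiply
`1/|ik₀ − e|² = 1/s` at zero transfer):

* PLAIN rung profile `P := a² − b² = w² + 2·w·b` (`w = a − b` the slice weight of `klwt_*`): same-slice + HARDER partner (p1 g7's
  `…SplitEdgeFacts(Mixed)` / `…SplitPartnerSlices` object);
* WICK rung profile `Z := (1 − b)² − (1 − a)² = w² + 2·w·(1 − a)`: same-slice + SOFTER partner (`klw_rung_pairs`, p1 g8);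
* TRANSFER profile `t_Λ := 2·h_Λ(1 − h_Λ)` (the hard⊗soft bubble weight of `𝒲₄ − 𝒱₄` at second order);
* the IDENTITY `P = Z + t_{Λ_{n−1}} − t_{Λ_n}` (ring) — the transfer is absorbed exactly into the plain rung at the resolvent level
  (HOME/hubbard-kl-k3c2-p2/TRANSFER-NOTE.md, evidence #22 on 19918);
* signs `P, Z, t ≥ 0`, `t ≤ 1/2`; supports: `t_Λ` on `Λ²/4 < s < Λ²`, harder partner `w·b` on `4Λ_n² < s < 16Λ_n²`, softer partner `w(1−a)` on
  `Λ_n²/4 < s < Λ_n²`;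
* certified `ds/s` masses (crude: `χ(1−χ) ≤ 1/4`, `w ≤ 1`): `∫ t_Λ ds/s ≤ ½·log 4`, `∫ w·b ds/s ≤ ¼·log 4`, `∫ w(1−a) ds/s ≤ ¼·log 4`,
  `∫ w² ds/s ≤ log 64` (numerals `½ log 4 ≤ 7/10`, `¼ log 4 ≤ 7/20`, `log 64 ≤ 21/5`), hence `∫ P ds/s, ∫ Z ds/s ≤ log 64 + ½ log 4` — the
  scale-free 1-D inputs that the sharp radial mass lemma
  (`…RadialMassSharp`, this seat) multiplies by the frame-band Jacobian (`B_J/(4π)`).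

Pure real analysis of the tree's cutoff; nothing about the effective action is asserted.
-/

noncomputable section

namespace Summit.HubbardSuperconductivity.HubbardSuperconductivity.Theorems.KLRegimeSplit

set_option linter.dupNamespace false -- summit = problem name (single-conjunct summit), D-0017

open Real Set MeasureTheory intervalIntegral Literature.MathematicalPhysics.QuantumLattice Literature.Probability.LatticeModels
open Summit.HubbardSuperconductivity.HubbardSuperconductivity.Theorems.KLProgrammeLegKernels

/-! ## §1 Pointwise algebra in the two hard weights `a`, `b` -/

/-- **Plain rung = same-slice + harder partner**: `a² − b² = (a − b)² + 2·((a − b)·b)`. -/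
theorem klrc_plain_rung_eq (a b : ℝ) : a ^ 2 - b ^ 2 = (a - b) ^ 2 + 2 * ((a - b) * b) := by ring

/-- **Wick rung = same-slice + softer partner**: `(1 − b)² − (1 − a)² = (a − b)² + 2·((a − b)·(1 − a))`. -/
theorem klrc_wick_rung_eq (a b : ℝ) : (1 - b) ^ 2 - (1 - a) ^ 2 = (a - b) ^ 2 + 2 * ((a - b) * (1 - a)) := by ring

/-- **The transfer identity**: PLAIN rung `=` WICK rung `+` transfer at the old scale `−` transfer at the new scale,
`a² − b² = ((1 − b)² − (1 − a)²) + 2b(1 − b) − 2a(1 − a)`. -/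
theorem klrc_plain_eq_wick_add_transfer_sub (a b : ℝ) :
    a ^ 2 - b ^ 2 = ((1 - b) ^ 2 - (1 - a) ^ 2) + 2 * (b * (1 - b)) - 2 * (a * (1 - a)) := by ring

/-- The plain rung profile is nonnegative when `0 ≤ b ≤ a`. -/
theorem klrc_plain_rung_nonneg {a b : ℝ} (hb : 0 ≤ b) (hba : b ≤ a) : 0 ≤ a ^ 2 - b ^ 2 := by nlinarith

/-- The Wick rung profile is nonnegative when `b ≤ a ≤ 1`. -/
theorem klrc_wick_rung_nonneg {a b : ℝ} (hba : b ≤ a) (ha : a ≤ 1) : 0 ≤ (1 - b) ^ 2 - (1 - a) ^ 2 := by nlinarith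

/-- The transfer profile `2h(1 − h)` is nonnegative and at most `1/2` for `h ∈ [0, 1]`. -/
theorem klrc_transfer_nonneg {h : ℝ} (h0 : 0 ≤ h) (h1 : h ≤ 1) : 0 ≤ 2 * (h * (1 - h)) := by nlinarith

/-- `2h(1 − h) ≤ 1/2`. -/
theorem klrc_transfer_le_half (h : ℝ) : 2 * (h * (1 - h)) ≤ 1 / 2 := by nlinarith [sq_nonneg (h - 1 / 2)]

/-- The harder-partner product `(a − b)·b` is nonnegative and at most `1/4` for `0 ≤ b ≤ a ≤ 1`. -/
theorem klrc_harder_partner_mem {a b : ℝ} (hb : 0 ≤ b) (hba : b ≤ a) (ha : a ≤ 1) :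
    0 ≤ (a - b) * b ∧ (a - b) * b ≤ 1 / 4 := by
  refine ⟨by nlinarith, ?_⟩
  nlinarith [sq_nonneg (a / 2 - b), sq_nonneg a]

/-- The softer-partner product `(a − b)·(1 − a)` is nonnegative and at most `1/4` for `0 ≤ b ≤ a ≤ 1`. -/
theorem klrc_softer_partner_mem {a b : ℝ} (hb : 0 ≤ b) (hba : b ≤ a) (ha : a ≤ 1) :
    0 ≤ (a - b) * (1 - a) ∧ (a - b) * (1 - a) ≤ 1 / 4 := by
  refine ⟨by nlinarith, ?_⟩
  nlinarith [sq_nonneg ((1 + b) / 2 - a), sq_nonneg (1 - b)]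

/-! ## §2 The carrier's weights: order, range, supports -/

/-- `χ₂ ≥ 0`. -/
theorem klrc_chi_nonneg (x : ℝ) : 0 ≤ salmhoferCutoff x := (salmhoferCutoff_mem_Icc x).1

/-- `χ₂ ≤ 1`. -/
theorem klrc_chi_le_one (x : ℝ) : salmhoferCutoff x ≤ 1 := (salmhoferCutoff_mem_Icc x).2

/-- **`b ≤ a`**: the weight above the larger scale is below the weight above the smaller one, `χ₂(s/Λ′²) ≤ χ₂(s/Λ²)` for `0 < Λ ≤ Λ′`, `0 ≤ s`. -/
theorem klrc_hard_weight_anti {Λ Λ' s : ℝ} (hΛ : 0 < Λ) (hΛΛ' : Λ ≤ Λ') (hs : 0 ≤ s) :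
    salmhoferCutoff (s / Λ' ^ 2) ≤ salmhoferCutoff (s / Λ ^ 2) := by
  refine monotone_salmhoferCutoff ?_
  exact div_le_div_of_nonneg_left hs (by positivity) (pow_le_pow_left₀ hΛ.le hΛΛ' 2)

/-- The transfer weight `χ₂(s/Λ²)(1 − χ₂(s/Λ²))` vanishes for `s ≤ Λ²/4`. -/
theorem klrc_transfer_zero_of_le {Λ s : ℝ} (hΛ : 0 < Λ) (hs : s ≤ Λ ^ 2 / 4) :
    salmhoferCutoff (s / Λ ^ 2) * (1 - salmhoferCutoff (s / Λ ^ 2)) = 0 := by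
  rw [salmhoferCutoff_of_le, zero_mul]
  rw [div_le_iff₀ (by positivity)]; linarith

/-- The transfer weight vanishes for `Λ² ≤ s`. -/
theorem klrc_transfer_zero_of_ge {Λ s : ℝ} (hΛ : 0 < Λ) (hs : Λ ^ 2 ≤ s) :
    salmhoferCutoff (s / Λ ^ 2) * (1 - salmhoferCutoff (s / Λ ^ 2)) = 0 := by
  rw [salmhoferCutoff_of_ge, sub_self, mul_zero]
  rwa [le_div_iff₀ (by positivity), one_mul]

/-- The transfer weight vanishes off the open transition shell `(Λ²/4, Λ²)`. -/
theorem klrc_transfer_zero_of_not_mem {Λ s : ℝ} (hΛ : 0 < Λ) (hs : s ∉ Ioo (Λ ^ 2 / 4) (Λ ^ 2)) :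
    salmhoferCutoff (s / Λ ^ 2) * (1 - salmhoferCutoff (s / Λ ^ 2)) = 0 := by
  rw [mem_Ioo, not_and_or, not_lt, not_lt] at hs
  rcases hs with hs | hs
  · exact klrc_transfer_zero_of_le hΛ hs
  · exact klrc_transfer_zero_of_ge hΛ hs

/-- The harder-partner weight `w·b = (χ₂(s/Λ²) − χ₂(s/(4Λ)²))·χ₂(s/(4Λ)²)` vanishes for `s ≤ 4Λ²`. -/
theorem klrc_harder_partner_zero_of_le {Λ s : ℝ} (hΛ : 0 < Λ) (hs : s ≤ 4 * Λ ^ 2) :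
    (salmhoferCutoff (s / Λ ^ 2) - salmhoferCutoff (s / (4 * Λ) ^ 2)) * salmhoferCutoff (s / (4 * Λ) ^ 2) = 0 := by
  rw [salmhoferCutoff_of_le (x := s / (4 * Λ) ^ 2), mul_zero]
  rw [div_le_iff₀ (by positivity)]; nlinarith

/-- The harder-partner weight vanishes for `16Λ² ≤ s` (there the slice weight is `1 − 1`). -/
theorem klrc_harder_partner_zero_of_ge {Λ s : ℝ} (hΛ : 0 < Λ) (hs : 16 * Λ ^ 2 ≤ s) :
    (salmhoferCutoff (s / Λ ^ 2) - salmhoferCutoff (s / (4 * Λ) ^ 2)) * salmhoferCutoff (s / (4 * Λ) ^ 2) = 0 := by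
  have h := klwt_zero_of_ge hΛ s (by nlinarith)
  have h' : salmhoferCutoff (s / Λ ^ 2) - salmhoferCutoff (s / (4 * Λ) ^ 2) = 0 := by exact_mod_cast h
  rw [h', zero_mul]

/-- The softer-partner weight `w·(1 − a) = (χ₂(s/Λ²) − χ₂(s/(4Λ)²))·(1 − χ₂(s/Λ²))` vanishes for `s ≤ Λ²/4`. -/
theorem klrc_softer_partner_zero_of_le {Λ s : ℝ} (hΛ : 0 < Λ) (hs : s ≤ Λ ^ 2 / 4) :
    (salmhoferCutoff (s / Λ ^ 2) - salmhoferCutoff (s / (4 * Λ) ^ 2)) * (1 - salmhoferCutoff (s / Λ ^ 2)) = 0 := by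
  have h := klwt_zero_of_le hΛ s (by nlinarith)
  have h' : salmhoferCutoff (s / Λ ^ 2) - salmhoferCutoff (s / (4 * Λ) ^ 2) = 0 := by exact_mod_cast h
  rw [h', zero_mul]

/-- The softer-partner weight vanishes for `Λ² ≤ s`. -/
theorem klrc_softer_partner_zero_of_ge {Λ s : ℝ} (hΛ : 0 < Λ) (hs : Λ ^ 2 ≤ s) :
    (salmhoferCutoff (s / Λ ^ 2) - salmhoferCutoff (s / (4 * Λ) ^ 2)) * (1 - salmhoferCutoff (s / Λ ^ 2)) = 0 := by
  rw [salmhoferCutoff_of_ge (x := s / Λ ^ 2), sub_self, mul_zero]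
  rwa [le_div_iff₀ (by positivity), one_mul]

/-- **At a ladder step** (`Λ = Λ_n`, `Λ′ = 4Λ_n`): with `a = χ₂(s/Λ²)`, `b = χ₂(s/(4Λ)²)`, one has `0 ≤ b ≤ a ≤ 1` for `0 ≤ s`, hence the
plain rung, the Wick rung and both transfer weights are nonnegative, and the transfer identity holds. -/
theorem klrc_step_profiles {Λ s : ℝ} (hΛ : 0 < Λ) (hs : 0 ≤ s) :
    0 ≤ salmhoferCutoff (s / (4 * Λ) ^ 2) ∧ salmhoferCutoff (s / (4 * Λ) ^ 2) ≤ salmhoferCutoff (s / Λ ^ 2) ∧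
      salmhoferCutoff (s / Λ ^ 2) ≤ 1 ∧
    0 ≤ salmhoferCutoff (s / Λ ^ 2) ^ 2 - salmhoferCutoff (s / (4 * Λ) ^ 2) ^ 2 ∧
    0 ≤ (1 - salmhoferCutoff (s / (4 * Λ) ^ 2)) ^ 2 - (1 - salmhoferCutoff (s / Λ ^ 2)) ^ 2 ∧
    salmhoferCutoff (s / Λ ^ 2) ^ 2 - salmhoferCutoff (s / (4 * Λ) ^ 2) ^ 2 =
      ((1 - salmhoferCutoff (s / (4 * Λ) ^ 2)) ^ 2 - (1 - salmhoferCutoff (s / Λ ^ 2)) ^ 2) +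
        2 * (salmhoferCutoff (s / (4 * Λ) ^ 2) * (1 - salmhoferCutoff (s / (4 * Λ) ^ 2))) -
        2 * (salmhoferCutoff (s / Λ ^ 2) * (1 - salmhoferCutoff (s / Λ ^ 2))) := by
  have hba := klrc_hard_weight_anti (s := s) hΛ (by linarith : Λ ≤ 4 * Λ) hs
  exact ⟨klrc_chi_nonneg _, hba, klrc_chi_le_one _, klrc_plain_rung_nonneg (klrc_chi_nonneg _) hba,
    klrc_wick_rung_nonneg hba (klrc_chi_le_one _), klrc_plain_eq_wick_add_transfer_sub _ _⟩

/-! ## §3 Certified `ds/s` masses -/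

/-- Averaging lemma: if `g` is continuous on `[u, v]` (`0 < u ≤ v`) with `g ≤ C` there, then `∫_u^v g(s)/s ds ≤ C·log(v/u)`. -/
theorem klrc_integral_div_le_mul_log {g : ℝ → ℝ} {u v C : ℝ} (hu : 0 < u) (huv : u ≤ v) (hg : ContinuousOn g (Icc u v))
    (hgC : ∀ s ∈ Icc u v, g s ≤ C) : ∫ s in u..v, g s / s ≤ C * Real.log (v / u) := by
  have hpos : ∀ s ∈ Icc u v, 0 < s := fun s hs => lt_of_lt_of_le hu hs.1
  have hint1 : IntervalIntegrable (fun s => g s / s) volume u v :=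
    (hg.div continuousOn_id fun s hs => (hpos s hs).ne').intervalIntegrable_of_Icc huv
  have hint2 : IntervalIntegrable (fun s : ℝ => C * s⁻¹) volume u v :=
    (continuousOn_const.mul (continuousOn_inv₀.mono fun s hs => (hpos s hs).ne')).intervalIntegrable_of_Icc huv
  calc ∫ s in u..v, g s / s ≤ ∫ s in u..v, C * s⁻¹ :=
        intervalIntegral.integral_mono_on huv hint1 hint2 fun s hs => by
          rw [div_eq_mul_inv]
          exact mul_le_mul_of_nonneg_right (hgC s hs) (inv_nonneg.2 (hpos s hs).le)
    _ = C * Real.log (v / u) := by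
        rw [intervalIntegral.integral_const_mul, integral_inv (Set.notMem_uIcc_of_lt hu (lt_of_lt_of_le hu huv))]

/-- From the open-shell support to the half-line: if `G = 0` off `(u, v)` with `0 < u ≤ v`, then `∫_{s>0} G(s)/s ds = ∫_u^v G(s)/s ds`. -/
theorem klrc_setIntegral_Ioi_div_eq {G : ℝ → ℝ} {u v : ℝ} (hu : 0 < u) (huv : u ≤ v) (hG : ∀ s, s ∉ Ioo u v → G s = 0) :
    ∫ s in Ioi 0, G s / s = ∫ s in u..v, G s / s := by
  rw [intervalIntegral.integral_of_le huv]
  refine setIntegral_eq_of_subset_of_forall_sdiff_eq_zero measurableSet_Ioi (fun s hs => lt_trans hu hs.1) fun s hs => ?_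
  have hs' : s ∉ Ioo u v := fun h => hs.2 ⟨h.1, h.2.le⟩
  rw [hG s hs', zero_div]

/-- `χ₂` is continuous. -/
theorem klrc_continuous_chi : Continuous salmhoferCutoff := contDiff_salmhoferCutoff (n := 0) |>.continuous

/-- **Transfer mass**: `∫_{s>0} 2χ₂(s/Λ²)(1 − χ₂(s/Λ²)) ds/s ≤ ½·log 4` (the transition shell `(Λ²/4, Λ²)` has `log`-length `log 4` and
`2χ(1 − χ) ≤ 1/2`). -/
theorem klrc_transfer_mass_le {Λ : ℝ} (hΛ : 0 < Λ) :
    ∫ s in Ioi 0, 2 * (salmhoferCutoff (s / Λ ^ 2) * (1 - salmhoferCutoff (s / Λ ^ 2))) / s ≤ 1 / 2 * Real.log 4 := by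
  have hu : 0 < Λ ^ 2 / 4 := by positivity
  have huv : Λ ^ 2 / 4 ≤ Λ ^ 2 := by nlinarith
  rw [klrc_setIntegral_Ioi_div_eq hu huv fun s hs => by rw [klrc_transfer_zero_of_not_mem hΛ hs, mul_zero]]
  have hlog : Real.log (Λ ^ 2 / (Λ ^ 2 / 4)) = Real.log 4 := by
    rw [show Λ ^ 2 / (Λ ^ 2 / 4) = 4 by field_simp]
  have hcont : ContinuousOn (fun s => 2 * (salmhoferCutoff (s / Λ ^ 2) * (1 - salmhoferCutoff (s / Λ ^ 2)))) (Icc (Λ ^ 2 / 4) (Λ ^ 2)) := by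
    have hc : Continuous fun s : ℝ => salmhoferCutoff (s / Λ ^ 2) := klrc_continuous_chi.comp (continuous_id.div_const _)
    exact (continuous_const.mul (hc.mul (continuous_const.sub hc))).continuousOn
  refine (klrc_integral_div_le_mul_log hu huv hcont fun s _ => klrc_transfer_le_half _).trans (le_of_eq ?_)
  rw [hlog]

/-- **Harder-partner mass**: `∫_{s>0} (χ₂(s/Λ²) − χ₂(s/(4Λ)²))·χ₂(s/(4Λ)²) ds/s ≤ ¼·log 4`. -/
theorem klrc_harder_partner_mass_le {Λ : ℝ} (hΛ : 0 < Λ) :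
    ∫ s in Ioi 0, (salmhoferCutoff (s / Λ ^ 2) - salmhoferCutoff (s / (4 * Λ) ^ 2)) * salmhoferCutoff (s / (4 * Λ) ^ 2) / s ≤
      1 / 4 * Real.log 4 := by
  have hu : 0 < 4 * Λ ^ 2 := by positivity
  have huv : 4 * Λ ^ 2 ≤ 16 * Λ ^ 2 := by nlinarith
  have hzero : ∀ s, s ∉ Ioo (4 * Λ ^ 2) (16 * Λ ^ 2) →
      (salmhoferCutoff (s / Λ ^ 2) - salmhoferCutoff (s / (4 * Λ) ^ 2)) * salmhoferCutoff (s / (4 * Λ) ^ 2) = 0 := by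
    intro s hs
    rw [mem_Ioo, not_and_or, not_lt, not_lt] at hs
    rcases hs with hs | hs
    · exact klrc_harder_partner_zero_of_le hΛ hs
    · exact klrc_harder_partner_zero_of_ge hΛ hs
  rw [klrc_setIntegral_Ioi_div_eq hu huv hzero]
  have hlog : Real.log (16 * Λ ^ 2 / (4 * Λ ^ 2)) = Real.log 4 := by
    rw [show (16 : ℝ) * Λ ^ 2 / (4 * Λ ^ 2) = 4 by field_simp; norm_num]
  have hc : Continuous fun s : ℝ => salmhoferCutoff (s / Λ ^ 2) := klrc_continuous_chi.comp (continuous_id.div_const _)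
  have hc' : Continuous fun s : ℝ => salmhoferCutoff (s / (4 * Λ) ^ 2) := klrc_continuous_chi.comp (continuous_id.div_const _)
  have hcont : ContinuousOn (fun s => (salmhoferCutoff (s / Λ ^ 2) - salmhoferCutoff (s / (4 * Λ) ^ 2)) *
      salmhoferCutoff (s / (4 * Λ) ^ 2)) (Icc (4 * Λ ^ 2) (16 * Λ ^ 2)) := ((hc.sub hc').mul hc').continuousOn
  refine (klrc_integral_div_le_mul_log hu huv hcont fun s hs => ?_).trans (le_of_eq (by rw [hlog]))
  have hs0 : 0 ≤ s := le_trans hu.le hs.1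
  exact (klrc_harder_partner_mem (klrc_chi_nonneg _) (klrc_hard_weight_anti hΛ (by linarith) hs0) (klrc_chi_le_one _)).2

/-- **Softer-partner mass**: `∫_{s>0} (χ₂(s/Λ²) − χ₂(s/(4Λ)²))·(1 − χ₂(s/Λ²)) ds/s ≤ ¼·log 4`. -/
theorem klrc_softer_partner_mass_le {Λ : ℝ} (hΛ : 0 < Λ) :
    ∫ s in Ioi 0, (salmhoferCutoff (s / Λ ^ 2) - salmhoferCutoff (s / (4 * Λ) ^ 2)) * (1 - salmhoferCutoff (s / Λ ^ 2)) / s ≤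
      1 / 4 * Real.log 4 := by
  have hu : 0 < Λ ^ 2 / 4 := by positivity
  have huv : Λ ^ 2 / 4 ≤ Λ ^ 2 := by nlinarith
  have hzero : ∀ s, s ∉ Ioo (Λ ^ 2 / 4) (Λ ^ 2) →
      (salmhoferCutoff (s / Λ ^ 2) - salmhoferCutoff (s / (4 * Λ) ^ 2)) * (1 - salmhoferCutoff (s / Λ ^ 2)) = 0 := by
    intro s hs
    rw [mem_Ioo, not_and_or, not_lt, not_lt] at hs
    rcases hs with hs | hs
    · exact klrc_softer_partner_zero_of_le hΛ hs
    · exact klrc_softer_partner_zero_of_ge hΛ hs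
  rw [klrc_setIntegral_Ioi_div_eq hu huv hzero]
  have hlog : Real.log (Λ ^ 2 / (Λ ^ 2 / 4)) = Real.log 4 := by
    rw [show Λ ^ 2 / (Λ ^ 2 / 4) = 4 by field_simp]
  have hc : Continuous fun s : ℝ => salmhoferCutoff (s / Λ ^ 2) := klrc_continuous_chi.comp (continuous_id.div_const _)
  have hc' : Continuous fun s : ℝ => salmhoferCutoff (s / (4 * Λ) ^ 2) := klrc_continuous_chi.comp (continuous_id.div_const _)
  have hcont : ContinuousOn (fun s => (salmhoferCutoff (s / Λ ^ 2) - salmhoferCutoff (s / (4 * Λ) ^ 2)) *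
      (1 - salmhoferCutoff (s / Λ ^ 2))) (Icc (Λ ^ 2 / 4) (Λ ^ 2)) := ((hc.sub hc').mul (continuous_const.sub hc)).continuousOn
  refine (klrc_integral_div_le_mul_log hu huv hcont fun s hs => ?_).trans (le_of_eq (by rw [hlog]))
  have hs0 : 0 ≤ s := le_trans hu.le hs.1
  exact (klrc_softer_partner_mem (klrc_chi_nonneg _) (klrc_hard_weight_anti hΛ (by linarith) hs0) (klrc_chi_le_one _)).2

/-- **Same-slice mass (crude)**: `∫_{s>0} (χ₂(s/Λ²) − χ₂(s/(4Λ)²))² ds/s ≤ log 64` (`w² ≤ 1` on the support `(Λ²/4, 16Λ²)`, of `log`-length `log 64`). -/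
theorem klrc_sameSlice_mass_le {Λ : ℝ} (hΛ : 0 < Λ) :
    ∫ s in Ioi 0, (salmhoferCutoff (s / Λ ^ 2) - salmhoferCutoff (s / (4 * Λ) ^ 2)) ^ 2 / s ≤ Real.log 64 := by
  have hu : 0 < Λ ^ 2 / 4 := by positivity
  have huv : Λ ^ 2 / 4 ≤ 16 * Λ ^ 2 := by nlinarith
  have hzero : ∀ s, s ∉ Ioo (Λ ^ 2 / 4) (16 * Λ ^ 2) → (salmhoferCutoff (s / Λ ^ 2) - salmhoferCutoff (s / (4 * Λ) ^ 2)) ^ 2 = 0 := by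
    intro s hs
    rw [mem_Ioo, not_and_or, not_lt, not_lt] at hs
    rcases hs with hs | hs
    · have h := klwt_zero_of_le hΛ s (by nlinarith)
      have h' : salmhoferCutoff (s / Λ ^ 2) - salmhoferCutoff (s / (4 * Λ) ^ 2) = 0 := by exact_mod_cast h
      rw [h', zero_pow two_ne_zero]
    · have h := klwt_zero_of_ge hΛ s (by nlinarith)
      have h' : salmhoferCutoff (s / Λ ^ 2) - salmhoferCutoff (s / (4 * Λ) ^ 2) = 0 := by exact_mod_cast h
      rw [h', zero_pow two_ne_zero]
  rw [klrc_setIntegral_Ioi_div_eq hu huv hzero]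
  have hlog : Real.log (16 * Λ ^ 2 / (Λ ^ 2 / 4)) = Real.log 64 := by
    rw [show (16 : ℝ) * Λ ^ 2 / (Λ ^ 2 / 4) = 64 by field_simp; norm_num]
  have hc : Continuous fun s : ℝ => salmhoferCutoff (s / Λ ^ 2) := klrc_continuous_chi.comp (continuous_id.div_const _)
  have hc' : Continuous fun s : ℝ => salmhoferCutoff (s / (4 * Λ) ^ 2) := klrc_continuous_chi.comp (continuous_id.div_const _)
  have hcont : ContinuousOn (fun s => (salmhoferCutoff (s / Λ ^ 2) - salmhoferCutoff (s / (4 * Λ) ^ 2)) ^ 2)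
      (Icc (Λ ^ 2 / 4) (16 * Λ ^ 2)) := ((hc.sub hc').pow 2).continuousOn
  refine (klrc_integral_div_le_mul_log hu huv hcont fun s hs => ?_).trans (le_of_eq (by rw [hlog, one_mul]))
  have hs0 : 0 ≤ s := le_trans hu.le hs.1
  have hw0 : 0 ≤ salmhoferCutoff (s / Λ ^ 2) - salmhoferCutoff (s / (4 * Λ) ^ 2) :=
    sub_nonneg.2 (klrc_hard_weight_anti hΛ (by linarith) hs0)
  have hw1 : salmhoferCutoff (s / Λ ^ 2) - salmhoferCutoff (s / (4 * Λ) ^ 2) ≤ 1 := by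
    linarith [klrc_chi_le_one (s / Λ ^ 2), klrc_chi_nonneg (s / (4 * Λ) ^ 2)]
  nlinarith

/-- Numerics (`log 2 < 0.6931471808`): the transfer mass `½·log 4 ≤ 7/10`. -/
theorem klrc_half_log_four_le : 1 / 2 * Real.log 4 ≤ 7 / 10 := by
  have h : Real.log 4 = 2 * Real.log 2 := by
    rw [show (4 : ℝ) = 2 ^ 2 by norm_num, Real.log_pow]; norm_num
  rw [h]
  have := Real.log_two_lt_d9
  linarith

/-- The partner masses `¼·log 4 ≤ 7/20`. -/
theorem klrc_quarter_log_four_le : 1 / 4 * Real.log 4 ≤ 7 / 20 := by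
  have h : Real.log 4 = 2 * Real.log 2 := by
    rw [show (4 : ℝ) = 2 ^ 2 by norm_num, Real.log_pow]; norm_num
  rw [h]
  have := Real.log_two_lt_d9
  linarith

/-- `log 64 ≤ 21/5`. -/
theorem klrc_log_sixtyfour_le : Real.log 64 ≤ 21 / 5 := by
  have h : Real.log 64 = 6 * Real.log 2 := by
    rw [show (64 : ℝ) = 2 ^ 6 by norm_num, Real.log_pow]; norm_num
  rw [h]
  have := Real.log_two_lt_d9
  linarith

/-! ## §4 At a ladder step `n ≥ 1` (`Λ = Λ_n = klScale klE0 n`, `Λ_{n−1} = 4Λ_n`) -/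

/-- **The four masses at scale `n ≥ 1`**, in the carrier's own spelling `χ₂(s/Λ_n²)`, `χ₂(s/Λ_{n−1}²)`:
transfer `≤ ½ log 4`, harder partner `≤ ¼ log 4`, softer partner `≤ ¼ log 4`, same slice `≤ log 64`. -/
theorem klrc_step_masses {n : ℕ} (hn : 1 ≤ n) :
    (∫ s in Ioi 0, 2 * (salmhoferCutoff (s / klScale klE0 n ^ 2) * (1 - salmhoferCutoff (s / klScale klE0 n ^ 2))) / s ≤
        1 / 2 * Real.log 4) ∧
    (∫ s in Ioi 0, (salmhoferCutoff (s / klScale klE0 n ^ 2) - salmhoferCutoff (s / klScale klE0 (n - 1) ^ 2)) *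
        salmhoferCutoff (s / klScale klE0 (n - 1) ^ 2) / s ≤ 1 / 4 * Real.log 4) ∧
    (∫ s in Ioi 0, (salmhoferCutoff (s / klScale klE0 n ^ 2) - salmhoferCutoff (s / klScale klE0 (n - 1) ^ 2)) *
        (1 - salmhoferCutoff (s / klScale klE0 n ^ 2)) / s ≤ 1 / 4 * Real.log 4) ∧
    (∫ s in Ioi 0, (salmhoferCutoff (s / klScale klE0 n ^ 2) - salmhoferCutoff (s / klScale klE0 (n - 1) ^ 2)) ^ 2 / s ≤
        Real.log 64) := by
  have hΛ := klth_klScale_pos n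
  have hpred : klScale klE0 (n - 1) = 4 * klScale klE0 n := by
    obtain ⟨m, rfl⟩ : ∃ m, n = m + 1 := ⟨n - 1, by omega⟩
    rw [Nat.add_sub_cancel, klth_klScale_succ]; ring
  rw [hpred]
  exact ⟨klrc_transfer_mass_le hΛ, klrc_harder_partner_mass_le hΛ, klrc_softer_partner_mass_le hΛ, klrc_sameSlice_mass_le hΛ⟩

end Summit.HubbardSuperconductivity.HubbardSuperconductivity.Theorems.KLRegimeSplit

end
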